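import Summits.HubbardSuperconductivity.HubbardSuperconductivity.Theses.LiebTwin
import Literature.Barriers.HubbardSuperconductivity.PureModelStripeCompetitionProofs
import HarnessLib

/-!
# Route `LiebTwin`, support `LiebTwinFloor` (item `stmt-HubbardSuperconductivity-15659`)

Closes `Summit.HubbardSuperconductivity.HubbardSuperconductivity.Theses.LiebTwin.LiebTwinFloor`:
`TwinOnsiteCondensation → NoOnsiteODLRO → DWavePolarisedDiscordance → RealFlipDefiniteSuffices →`
there are `U > 0`, `δ ∈ (0, 1/2)`, `a > 0`, `L₀` such that for every even `L ≥ L₀` EVERY normalised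
`(N_L, 0)`-sector ground state `ψ` of `hubbardTorus 2 L 1 U` (`N_L = 2⌊(1-δ)L²/2⌋`) has
`a·L⁴ ≤ Re⟨ψ, Δ_dᴴ Δ_d ψ⟩`, `Δ_d = pairField dWaveFormFactor L`.

The floor (bookkeeping, as in the route's deciding theorem `LiebTwin.closes` but UNIFORM over ground
states): K2 gives a box point `(U, δ)` and `c > 0` with `F_s(φ̃) ≥ cL⁴` for the twin of every
normalised ground state; `NoOnsiteODLRO`, which is stated along admissible SEQUENCES, is first made
uniform over ground states by a selection argument (`eventually_uniform_of_noOnsiteODLRO`: were the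
uniform bound `F_s(ψ) ≤ (c/4)L⁴` to fail for arbitrarily large even `L`, choosing a violating ground
state where one exists and any normalised ground state elsewhere —
`exists_unit_isGroundStateInSector_hubbardTorus` — assembles an admissible sequence contradicting
`NoOnsiteODLRO`); K3' at `(U, δ)` with `ε = κc/4` and `F_d(φ̃) ≥ 0` then give
`F_d(ψ) ≥ κ(F_s(φ̃) − F_s(ψ)) − (κc/4)L⁴ ≥ κ(c − c/4)L⁴ − (κc/4)L⁴ = (κc/2)L⁴ ≥ (κc/4)L⁴`. Since rev 1
of the route states K2 and K3' over every normalised ground state, the hypothesis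
`RealFlipDefiniteSuffices` is not consumed. Sources: Lieb, PRL **62** (1989) 1201; Scalapino, Phys. Rep.
**250** (1995) 329, §2. No definition and no named fact is introduced.
-/

-- the mandated namespace `Summit.<Summit>.<Problem>.Theorems` repeats `HubbardSuperconductivity`
-- (single-problem summit, D-0017), which the `dupNamespace` linter flags on every declaration
set_option linter.dupNamespace false

namespace Summit.HubbardSuperconductivity.HubbardSuperconductivity.Theorems

open Matrix Literature.MathematicalPhysics.QuantumLattice Literature.Barriers.HubbardSuperconductivity
open Summit.HubbardSuperconductivity.HubbardSuperconductivity.Theses.LiebTwin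

/-- **`NoOnsiteODLRO` made uniform over ground states** (selection argument): if every admissible
ground-state sequence has `L⁻⁴ F_s(ψ_L) → 0` along even `L`, then for every `ε > 0`, eventually in even
`L`, EVERY normalised `(N_L, 0)`-sector ground state `ψ` of `hubbardTorus 2 L 1 U` has
`L⁻⁴ Re⟨ψ, Δ_sᴴ Δ_s ψ⟩ ≤ ε`. Otherwise pick, at each side `L`, a violating normalised ground state if
there is one and any normalised ground state otherwise (they exist on every torus,
`exists_unit_isGroundStateInSector_hubbardTorus`): an admissible sequence violating the bound at
arbitrarily large even `L`, contradicting `NoOnsiteODLRO`. [folklore] -/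
theorem eventually_uniform_of_noOnsiteODLRO (hNo : NoOnsiteODLRO) {U δ ε : ℝ} (hU : 0 < U)
    (hδ : δ ∈ Set.Ioo (0 : ℝ) (1 / 2)) (hε : 0 < ε) :
    ∃ L₂ : ℕ, ∀ (L : ℕ) [NeZero L], Even L → L₂ ≤ L → ∀ ψ : Fock (Orb (FermionTorus 2 L)),
      star ψ ⬝ᵥ ψ = 1 →
        IsGroundStateInSector (hubbardTorus 2 L 1 U) (2 * ⌊(1 - δ) * (L : ℝ) ^ 2 / 2⌋₊) 0 ψ →
          (expect ((pairField sWave L)ᴴ * pairField sWave L) ψ).re / (L : ℝ) ^ 4 ≤ ε := by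
  classical
  by_contra hcon
  push Not at hcon
  -- `bad L ψ`: `ψ` is a normalised sector ground state on a nonzero side `L` violating the bound
  let bad : ∀ L : ℕ, Fock (Orb (FermionTorus 2 L)) → Prop := fun L ψ =>
    ∃ _ : NeZero L, star ψ ⬝ᵥ ψ = 1 ∧
      IsGroundStateInSector (hubbardTorus 2 L 1 U) (2 * ⌊(1 - δ) * (L : ℝ) ^ 2 / 2⌋₊) 0 ψ ∧
        ε < (expect ((pairField sWave L)ᴴ * pairField sWave L) ψ).re / (L : ℝ) ^ 4
  -- a violating ground state where one exists, any normalised ground state elsewhere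
  have key : ∀ L : ℕ, ∃ ψ : Fock (Orb (FermionTorus 2 L)),
      (star ψ ⬝ᵥ ψ = 1 ∧
        IsGroundStateInSector (hubbardTorus 2 L 1 U) (2 * ⌊(1 - δ) * (L : ℝ) ^ 2 / 2⌋₊) 0 ψ) ∧
      ((∃ φ, bad L φ) → bad L ψ) := by
    intro L
    by_cases h : ∃ φ, bad L φ
    · obtain ⟨φ, hL, h1, h2, h3⟩ := h
      exact ⟨φ, ⟨h1, h2⟩, fun _ => ⟨hL, h1, h2, h3⟩⟩
    · obtain ⟨φ, h1, h2⟩ := exists_unit_isGroundStateInSector_hubbardTorus U L _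
        (natFloor_filling_le_sq (δ := δ) (by linarith [hδ.1]) L)
      exact ⟨φ, ⟨h1, h2⟩, fun h' => absurd h' h⟩
  choose ψ hψ hbad using key
  -- `NoOnsiteODLRO` along the assembled admissible sequence
  obtain ⟨L₀, hL₀⟩ := hNo U δ hU hδ (fun L => 2 * ⌊(1 - δ) * (L : ℝ) ^ 2 / 2⌋₊) ψ
    (fun L _ => ⟨rfl, (hψ L).1, (hψ L).2⟩) ε hε
  -- a violating side `L ≥ L₀`: there `ψ L` is itself violating
  obtain ⟨L, inst, hE, hL, φ, hφ1, hφ2, hφ3⟩ := hcon L₀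
  obtain ⟨_, -, -, hlt⟩ := hbad L ⟨φ, inst, hφ1, hφ2, hφ3⟩
  exact absurd (hL₀ L hE hL) (not_le.2 hlt)

/-- **The floor of route `LiebTwin`** (support `LiebTwinFloor`, item `stmt-HubbardSuperconductivity-15659`):
K2 (`TwinOnsiteCondensation`) at its box point `(U, δ)`, `NoOnsiteODLRO` made uniform over ground states
(`eventually_uniform_of_noOnsiteODLRO`, `ε = c/4`) and K3' (`DWavePolarisedDiscordance`) at `(U, δ)` with
`ε = κc/4`, together with `F_d(φ̃) ≥ 0`, give `(κc/4)·L⁴ ≤ Re⟨ψ, Δ_dᴴ Δ_d ψ⟩` for EVERY normalised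
`(N_L, 0)`-sector ground state `ψ` of `hubbardTorus 2 L 1 U`, eventually in even `L`; `0 < U ≤ 4` and
`[1/10, 3/10] ⊂ (0, 1/2)` give the side conditions. (`RealFlipDefiniteSuffices` is not needed: rev 1 of
the route states K2 and K3' over every normalised ground state.) Lieb, PRL 62 (1989) 1201; Scalapino,
Phys. Rep. 250 (1995) 329, §2. [folklore] -/
theorem liebTwinFloor_proof :
    Summit.HubbardSuperconductivity.HubbardSuperconductivity.Theses.LiebTwin.LiebTwinFloor := by
  intro hK2 hNo hK3 _
  -- K2: a box point `(U, δ)` where the twin of EVERY normalised sector ground state condenses on-site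
  obtain ⟨U, hU, δ, hδ, c, hc, L₀, h2⟩ := hK2
  have hU0 : 0 < U := hU.1
  have hδ' : δ ∈ Set.Ioo (0 : ℝ) (1 / 2) := ⟨by linarith [hδ.1], by linarith [hδ.2]⟩
  -- K3' at `(U, δ)` with `ε := κc/4`
  obtain ⟨κ, hκ, h3⟩ := hK3 U hU δ hδ
  obtain ⟨L₁, h3⟩ := h3 (κ * c / 4) (by positivity)
  -- `NoOnsiteODLRO`, uniform over ground states, with `ε := c/4`
  obtain ⟨L₂, hNo'⟩ := eventually_uniform_of_noOnsiteODLRO hNo hU0 hδ' (show (0 : ℝ) < c / 4 by positivity)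
  refine ⟨U, hU0, δ, hδ', κ * c / 4, by positivity, L₀ + L₁ + L₂, ?_⟩
  intro L _ hL hE ψ hu hgs
  have h2' := h2 L (by omega) hE ψ hu hgs
  have h3' := h3 L (by omega) hE ψ hu hgs
  have hLpos : (0 : ℝ) < (L : ℝ) := Nat.cast_pos.2 (Nat.pos_of_ne_zero (NeZero.ne L))
  have hL4 : (0 : ℝ) < (L : ℝ) ^ 4 := pow_pos hLpos 4
  have hFs := (div_le_iff₀ hL4).1 (hNo' L hE (by omega) ψ hu hgs)
  -- `Re⟨χ, Δ_d†Δ_d χ⟩ = ‖Δ_d χ‖² ≥ 0` for the twin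
  have hnn : ∀ χ : Fock (Orb (FermionTorus 2 L)),
      0 ≤ (expect ((pairField dWaveFormFactor L)ᴴ * pairField dWaveFormFactor L) χ).re := by
    intro χ
    rw [PosSemidefTrace.expect_conjTranspose_mul, ← norm_toLp_sq_eq_re]
    positivity
  have hX : 0 ≤ κ * c * (L : ℝ) ^ 4 := (mul_pos (mul_pos hκ hc) hL4).le
  have aux : ∀ A B D E X : ℝ, κ * (A - B) - κ * c / 4 * X ≤ D - E → 0 ≤ E → c * X ≤ A →
      B ≤ c / 4 * X → 0 ≤ κ * c * X → κ * c / 4 * X ≤ D := by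
    intro A B D E X i1 i2 i3 i4 i5
    have j3 := mul_le_mul_of_nonneg_left i3 hκ.le
    have j4 := mul_le_mul_of_nonneg_left i4 hκ.le
    nlinarith
  exact aux _ _ _ _ _ h3' (hnn _) h2' hFs hX

end Summit.HubbardSuperconductivity.HubbardSuperconductivity.Theorems
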